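import Literature.Geometry.Riemannian.BakryEmerySpectralGap
import Literature.Geometry.Riemannian.WeightedHeatFlowAPriori
import Literature.Geometry.Riemannian.ShrinkerEntropyProofs
import Literature.Geometry.Lorentzian.GreenIdentityCompactSupport
import Literature.Analysis.FluidPDE.WeightedParametricIntegral
import HarnessLib

/-!
# Weighted Green identity and dissipation inequality with compactly supported cut-offs
# (crux `EntropyRung.NoncompactShrinkerGap`, stmt-SmoothPoincare4-10868, line `collapsed-ends-usc`,
# skeleton v13)

Auxiliary file of the registered helper `helper_weightedMaxPrinciple` (weak maximum principle for
subsolutions of the weighted heat equation `∂ₛz ≤ Lz`, `L = Δ_g − g⁻¹(dV, d·)`, on a COMPLETE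
weighted manifold, proved by the energy method with cut-offs in
`EntropyRungNoncompactShrinkerGapHeatMaxPrinciple.lean`). On a manifold `M` modelled on `ℝⁿ`
(Hausdorff, second countable, hence locally compact and σ-compact) with a Riemannian metric `g`,
its Levi-Civita connection and a smooth weight `V` we prove:

* `weightedLaplacian_affine` — `L(a u + b) = a Lu`; `weightedLaplacian_eq_zero_of_eventuallyEq_one`
  — `Lη(x) = 0` if `η = 1` near `x`; `continuous_hasCompactSupport_weightedLaplacian`;
* `integral_mul_weightedLaplacian_of_hasCompactSupport` — **the weighted Green identity**
  `∫ a (Lb) e^{-V} dV_g = −∫ g⁻¹(da, db) e^{-V} dV_g` for `a ∈ C¹`, `b ∈ C²` with `a` OR `b`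
  compactly supported (Green's first identity for compactly supported functions,
  `GreenIdentityCompactSupport.lean`, applied to `u = a e^{-V}`; the closed-manifold version is
  `integral_mul_weightedLaplacian` of `BakryEmeryHeatFlow.lean`);
* `integral_test_dissipation_le` — **the dissipation inequality of the energy method**: for smooth
  `w`, a smooth compactly supported cut-off `η ≥ 0` and a smooth convex test function `Φ ≥ 0`,
  `∫ η Φ'(w)(Lw) e^{-V} ≤ ∫ |Lη| Φ(w) e^{-V}` (two weighted Green identities and `Φ'' ≥ 0`).

References: A. Grigor'yan, *Heat kernel and analysis on manifolds* (2009), §3.6, §11.4, §12.1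
(weighted manifolds, energy estimates with cut-offs, uniqueness class for the Cauchy problem);
D. Bakry, I. Gentil, M. Ledoux, *Analysis and geometry of Markov diffusion operators* (2014),
§1.11.3, §3.2 (`∫ f Lg dμ = −∫ Γ(f,g) dμ` on weighted manifolds).
-/

noncomputable section

set_option linter.dupNamespace false

open scoped Manifold ContDiff ENNReal NNReal Topology
open MeasureTheory Set Filter
open Literature.Geometry.Lorentzian Literature.Geometry.Riemannian

namespace Summit.SmoothPoincare4.SmoothPoincare4.Theorems.NoncompactShrinkerGapHeat

section Weighted

variable {n : ℕ} {M : Type*} [TopologicalSpace M] [T2Space M] [SecondCountableTopology M]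
  [ChartedSpace (EuclideanSpace ℝ (Fin n)) M] [IsManifold (𝓡 n) ∞ M] [T3Space M]
  [MeasurableSpace M] [BorelSpace M]
  {g : PseudoRiemannianMetric (𝓡 n) ∞ (EuclideanSpace ℝ (Fin n)) (TangentSpace (𝓡 n) : M → Type _)}
  [g.HasLeviCivita]

/-! ### Pointwise facts on the weighted Laplacian `L u = Δu − g⁻¹(dV, du)` -/

omit [T2Space M] [SecondCountableTopology M] [T3Space M] [MeasurableSpace M] [BorelSpace M] in
/-- **`L(a u + b) = a Lu`** for constants `a, b` and `u` of class `C²` at the point (chain rule for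
`Δ_g` and `d` with the affine function `t ↦ a t + b`). [folklore] -/
theorem weightedLaplacian_affine {u V : M → ℝ} {x : M} (hu : ContMDiffAt (𝓡 n) 𝓘(ℝ, ℝ) 2 u x)
    (a b : ℝ) :
    g.dalembertian (fun y ↦ a * u y + b) x - g.innerDual x (mvfderiv (𝓡 n) V x).toLinearMap
        (mvfderiv (𝓡 n) (fun y ↦ a * u y + b) x).toLinearMap =
      a * (g.dalembertian u x - g.innerDual x (mvfderiv (𝓡 n) V x).toLinearMap
        (mvfderiv (𝓡 n) u x).toLinearMap) := by
  have hζ : ContDiff ℝ 2 (fun t : ℝ ↦ a * t + b) :=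
    (contDiff_const.mul contDiff_id).add contDiff_const
  have hζ1 : ∀ t, HasDerivAt (fun t : ℝ ↦ a * t + b) a t := fun t ↦ by
    simpa using ((hasDerivAt_id t).const_mul a).add_const b
  have hd1 : deriv (fun t : ℝ ↦ a * t + b) = fun _ ↦ a := funext fun t ↦ (hζ1 t).deriv
  have hcomp : (fun y ↦ a * u y + b) = (fun t : ℝ ↦ a * t + b) ∘ u := rfl
  have hΔ : g.dalembertian (fun y ↦ a * u y + b) x = a * g.dalembertian u x := by
    rw [hcomp, g.dalembertian_real_comp hu hζ.contDiffAt, hd1]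
    simp
  have hd : (mvfderiv (𝓡 n) (fun y ↦ a * u y + b) x).toLinearMap =
      a • (mvfderiv (𝓡 n) u x).toLinearMap := by
    ext v
    have h := mvfderiv_real_comp_apply (I := 𝓡 n) (hζ1 (u x)) (hu.mdifferentiableAt (by norm_num)) v
    simpa [hcomp] using h
  rw [hΔ, hd, g.innerDual_smul_right]
  ring

omit [T2Space M] [SecondCountableTopology M] [T3Space M] [MeasurableSpace M] [BorelSpace M] in
/-- **`Lη(x) = 0` if `η = 1` near `x`** (`η` smooth): `L(η − 1) = Lη` and `η − 1` vanishes near `x`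
(locality of `Δ_g` and of `d`). [folklore] -/
theorem weightedLaplacian_eq_zero_of_eventuallyEq_one {η V : M → ℝ} {x : M}
    (hη : ContMDiff (𝓡 n) 𝓘(ℝ, ℝ) ∞ η) (h : ∀ᶠ y in 𝓝 x, η y = 1) :
    g.dalembertian η x - g.innerDual x (mvfderiv (𝓡 n) V x).toLinearMap
      (mvfderiv (𝓡 n) η x).toLinearMap = 0 := by
  have h0 : (fun y ↦ (1 : ℝ) * η y + (-1)) =ᶠ[𝓝 x] fun _ ↦ 0 := h.mono fun y hy ↦ by simp [hy]
  have h2 : ContMDiffAt (𝓡 n) 𝓘(ℝ, ℝ) 2 η x :=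
    (hη.of_le (WithTop.coe_le_coe.mpr le_top)).contMDiffAt
  have key := weightedLaplacian_affine (g := g) (V := V) h2 1 (-1)
  rw [g.dalembertian_eq_zero_of_eventuallyEq_zero h0,
    PseudoRiemannianMetric.mvfderiv_eq_zero_of_eventuallyEq_zero (I := 𝓡 n) h0] at key
  simpa [PseudoRiemannianMetric.innerDual] using key.symm

omit [SecondCountableTopology M] [T3Space M] [MeasurableSpace M] [BorelSpace M] in
/-- The weighted Laplacian `Lη` of a smooth compactly supported `η` is continuous with compact
support (it vanishes off `tsupport η`). [folklore] -/
theorem continuous_hasCompactSupport_weightedLaplacian {η V : M → ℝ}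
    (hη : ContMDiff (𝓡 n) 𝓘(ℝ, ℝ) ∞ η) (hηc : HasCompactSupport η)
    (hV : ContMDiff (𝓡 n) 𝓘(ℝ, ℝ) ∞ V) :
    Continuous (fun x ↦ g.dalembertian η x - g.innerDual x (mvfderiv (𝓡 n) V x).toLinearMap
      (mvfderiv (𝓡 n) η x).toLinearMap) ∧
    HasCompactSupport (fun x ↦ g.dalembertian η x - g.innerDual x
      (mvfderiv (𝓡 n) V x).toLinearMap (mvfderiv (𝓡 n) η x).toLinearMap) := by
  refine ⟨(continuous_dalembertian g (hη.of_le (WithTop.coe_le_coe.mpr le_top))).sub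
    (continuous_innerDual_mvfderiv g (hV.of_le (by norm_num)) (hη.of_le (by norm_num))),
    HasCompactSupport.intro hηc fun x hx ↦ ?_⟩
  simp [g.dalembertian_eq_zero_of_notMem_tsupport hx, mvfderiv_eq_zero_of_notMem_tsupport hx,
    PseudoRiemannianMetric.innerDual]

/-! ### The weighted Green identity with one compactly supported factor -/

/-- **Weighted Green identity on a (non-compact) weighted manifold, one factor compactly
supported**: for `a ∈ C¹`, `b ∈ C²`, `V ∈ C¹` with `a` or `b` compactly supported,
`∫ a (Lb) e^{-V} dV_g = −∫ g⁻¹(da, db) e^{-V} dV_g`, `Lb = Δ_g b − g⁻¹(dV, db)` — Green's first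
identity for compactly supported functions (`GreenIdentityCompactSupport`) applied to
`u = a e^{-V}`, `f = b`, with `d(a e^{-V}) = e^{-V} da − a e^{-V} dV`; the manifold (modelled on
`ℝⁿ`, second countable) is locally compact and σ-compact. This is the integration by parts
`∫ f Lg dμ = −∫ Γ(f, g) dμ` of the Markov triple `(M, e^{-V}dV, Γ)` for compactly supported data.
[cite: BakryGentilLedoux2014, §3.2 (weighted Riemannian manifolds as Markov triples: integration by
parts for compactly supported smooth functions)] -/
theorem integral_mul_weightedLaplacian_of_hasCompactSupport (hg : g.IsRiemannian) {a b V : M → ℝ}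
    (ha : ContMDiff (𝓡 n) 𝓘(ℝ, ℝ) 1 a) (hb : ContMDiff (𝓡 n) 𝓘(ℝ, ℝ) 2 b)
    (hV : ContMDiff (𝓡 n) 𝓘(ℝ, ℝ) 1 V) (hc : HasCompactSupport a ∨ HasCompactSupport b) :
    ∫ x, a x * (g.dalembertian b x - g.innerDual x (mvfderiv (𝓡 n) V x).toLinearMap
        (mvfderiv (𝓡 n) b x).toLinearMap) * Real.exp (-V x) ∂g.riemVolume =
      -∫ x, g.innerDual x (mvfderiv (𝓡 n) a x).toLinearMap (mvfderiv (𝓡 n) b x).toLinearMap *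
        Real.exp (-V x) ∂g.riemVolume := by
  haveI : LocallyCompactSpace M := Manifold.locallyCompact_of_finiteDimensional (M := M) (𝓡 n)
  haveI : IsFiniteMeasureOnCompacts g.riemVolume :=
    CarrilloNi2009_shrinkerLSI.isFiniteMeasureOnCompacts_riemVolume hg
  have hexp : ContMDiff (𝓡 n) 𝓘(ℝ, ℝ) 1 (fun y ↦ Real.exp (-V y)) :=
    ((Real.contDiff_exp.comp contDiff_neg).of_le le_top).comp_contMDiff hV
  have hu : ContMDiff (𝓡 n) 𝓘(ℝ, ℝ) 1 (fun y ↦ a y * Real.exp (-V y)) := ha.mul hexp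
  have hb1 : ContMDiff (𝓡 n) 𝓘(ℝ, ℝ) 1 b := hb.of_le (by norm_num)
  -- Green's first identity for `u = a e^{-V}`, `f = b`, and a compact set off which things vanish
  obtain ⟨K, hK, hoff, hG⟩ : ∃ K : Set M, IsCompact K ∧
      (∀ x ∉ K, (a x = 0 ∧ mvfderiv (𝓡 n) a x = 0) ∨
        (g.dalembertian b x = 0 ∧ mvfderiv (𝓡 n) b x = 0)) ∧
      ∫ x, (a x * Real.exp (-V x)) * g.dalembertian b x ∂g.riemVolume =
        -∫ x, g.innerDual x (mvfderiv (𝓡 n) (fun y ↦ a y * Real.exp (-V y)) x).toLinearMap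
          (mvfderiv (𝓡 n) b x).toLinearMap ∂g.riemVolume := by
    haveI := (PseudoRiemannianMetric.ofRiemannian (g.toContMDiffRiemannianMetric hg)).hasLeviCivita
    rcases hc with hac | hbc
    · refine ⟨tsupport a, hac, fun x hx ↦ Or.inl ⟨image_eq_zero_of_notMem_tsupport hx,
        mvfderiv_eq_zero_of_notMem_tsupport hx⟩, ?_⟩
      have h1 := integral_mul_dalembertian_eq_neg_integral_innerDual_of_hasCompactSupport
        (g.toContMDiffRiemannianMetric hg) hu (hac.mul_right) hb
      rw [PseudoRiemannianMetric.riemVolume_eq hg]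
      exact h1
    · refine ⟨tsupport b, hbc, fun x hx ↦ Or.inr ⟨g.dalembertian_eq_zero_of_notMem_tsupport hx,
        mvfderiv_eq_zero_of_notMem_tsupport hx⟩, ?_⟩
      have h1 := integral_mul_dalembertian_eq_neg_integral_innerDual_of_hasCompactSupport_right
        (g.toContMDiffRiemannianMetric hg) hu hb hbc
      rw [PseudoRiemannianMetric.riemVolume_eq hg]
      exact h1
  -- the integrand of the right-hand side of Green, pointwise
  have hpt : ∀ x, g.innerDual x (mvfderiv (𝓡 n) (fun y ↦ a y * Real.exp (-V y)) x).toLinearMap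
        (mvfderiv (𝓡 n) b x).toLinearMap =
      g.innerDual x (mvfderiv (𝓡 n) a x).toLinearMap (mvfderiv (𝓡 n) b x).toLinearMap *
          Real.exp (-V x)
        - a x * g.innerDual x (mvfderiv (𝓡 n) V x).toLinearMap
            (mvfderiv (𝓡 n) b x).toLinearMap * Real.exp (-V x) := by
    intro x
    rw [mvfderiv_mul_exp_neg_toLinearMap (ha.mdifferentiableAt one_ne_zero)
      (hV.mdifferentiableAt one_ne_zero), g.innerDual_sub_left, g.innerDual_smul_left,
      g.innerDual_smul_left]
    ring
  -- continuity, vanishing off `K`, integrability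
  have hΔc : Continuous (g.dalembertian b) := continuous_dalembertian g hb
  have hIVc : Continuous fun x ↦ g.innerDual x (mvfderiv (𝓡 n) V x).toLinearMap
      (mvfderiv (𝓡 n) b x).toLinearMap := continuous_innerDual_mvfderiv g hV hb1
  have hIac : Continuous fun x ↦ g.innerDual x (mvfderiv (𝓡 n) a x).toLinearMap
      (mvfderiv (𝓡 n) b x).toLinearMap := continuous_innerDual_mvfderiv g ha hb1
  have hec : Continuous fun x ↦ Real.exp (-V x) := hexp.continuous
  have i1 : Integrable (fun x ↦ (a x * Real.exp (-V x)) * g.dalembertian b x) g.riemVolume := by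
    refine ((ha.continuous.mul hec).mul hΔc).integrable_of_hasCompactSupport
      (HasCompactSupport.intro hK fun x hx ↦ ?_)
    rcases hoff x hx with ⟨h0, -⟩ | ⟨h0, -⟩ <;> simp [h0]
  have i2 : Integrable (fun x ↦ a x * g.innerDual x (mvfderiv (𝓡 n) V x).toLinearMap
      (mvfderiv (𝓡 n) b x).toLinearMap * Real.exp (-V x)) g.riemVolume := by
    refine ((ha.continuous.mul hIVc).mul hec).integrable_of_hasCompactSupport
      (HasCompactSupport.intro hK fun x hx ↦ ?_)
    rcases hoff x hx with ⟨h0, -⟩ | ⟨-, h0⟩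
    · simp [h0]
    · simp [h0, PseudoRiemannianMetric.innerDual]
  have i3 : Integrable (fun x ↦ g.innerDual x (mvfderiv (𝓡 n) a x).toLinearMap
      (mvfderiv (𝓡 n) b x).toLinearMap * Real.exp (-V x)) g.riemVolume := by
    refine (hIac.mul hec).integrable_of_hasCompactSupport
      (HasCompactSupport.intro hK fun x hx ↦ ?_)
    rcases hoff x hx with ⟨-, h0⟩ | ⟨-, h0⟩ <;> simp [h0, PseudoRiemannianMetric.innerDual]
  -- split the integrals
  have s1 : ∫ x, a x * (g.dalembertian b x - g.innerDual x (mvfderiv (𝓡 n) V x).toLinearMap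
        (mvfderiv (𝓡 n) b x).toLinearMap) * Real.exp (-V x) ∂g.riemVolume =
      ∫ x, ((a x * Real.exp (-V x)) * g.dalembertian b x
        - a x * g.innerDual x (mvfderiv (𝓡 n) V x).toLinearMap
            (mvfderiv (𝓡 n) b x).toLinearMap * Real.exp (-V x)) ∂g.riemVolume :=
    integral_congr_ae (Eventually.of_forall fun x ↦ by ring)
  have s2 := integral_sub i1 i2
  have s3 : ∫ x, g.innerDual x (mvfderiv (𝓡 n) (fun y ↦ a y * Real.exp (-V y)) x).toLinearMap
        (mvfderiv (𝓡 n) b x).toLinearMap ∂g.riemVolume =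
      ∫ x, (g.innerDual x (mvfderiv (𝓡 n) a x).toLinearMap (mvfderiv (𝓡 n) b x).toLinearMap *
          Real.exp (-V x)
        - a x * g.innerDual x (mvfderiv (𝓡 n) V x).toLinearMap
            (mvfderiv (𝓡 n) b x).toLinearMap * Real.exp (-V x)) ∂g.riemVolume :=
    integral_congr_ae (Eventually.of_forall hpt)
  have s4 := integral_sub i3 i2
  linarith [hG, s1, s2, s3, s4]

/-! ### The dissipation inequality of the energy method -/

/-- **Dissipation inequality.** For smooth `w`, `V`, a smooth compactly supported `η ≥ 0` and a
`C^∞` test function `Φ ≥ 0` with `Φ'' ≥ 0`: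
`∫ η Φ'(w) (Lw) e^{-V} ≤ ∫ |Lη| Φ(w) e^{-V}`. Indeed, by the weighted Green identity (the factor
`Φ'(w) η` is compactly supported) the left side is `−∫ g⁻¹(d(Φ'(w)η), dw) e^{-V}
= −∫ Φ''(w) η |dw|² e^{-V} − ∫ Φ'(w) g⁻¹(dη, dw) e^{-V} ≤ −∫ g⁻¹(d(Φ∘w), dη) e^{-V}
= ∫ Φ(w) (Lη) e^{-V}` (Green again, `η` compactly supported), and `Φ(w) Lη ≤ |Lη| Φ(w)`. This is
the integration-by-parts step of the energy method (uniqueness class / maximum principle for the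
Cauchy problem of the heat equation on complete weighted manifolds via cut-off functions).
[cite: Grigoryan2009, §11.4 and §12.1 (energy estimates with cut-off functions on complete weighted
manifolds; integrated maximum principle)] -/
theorem integral_test_dissipation_le (hg : g.IsRiemannian) {w η V : M → ℝ}
    (hw : ContMDiff (𝓡 n) 𝓘(ℝ, ℝ) ∞ w) (hη : ContMDiff (𝓡 n) 𝓘(ℝ, ℝ) ∞ η)
    (hηc : HasCompactSupport η) (hη0 : ∀ x, 0 ≤ η x) (hV : ContMDiff (𝓡 n) 𝓘(ℝ, ℝ) ∞ V)
    {Φ : ℝ → ℝ} (hΦ : ContDiff ℝ ∞ Φ) (hΦ0 : ∀ t, 0 ≤ Φ t) (hΦ'' : ∀ t, 0 ≤ deriv (deriv Φ) t) :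
    ∫ x, (η x * Real.exp (-V x)) * (deriv Φ (w x) * (g.dalembertian w x -
        g.innerDual x (mvfderiv (𝓡 n) V x).toLinearMap (mvfderiv (𝓡 n) w x).toLinearMap))
        ∂g.riemVolume ≤
      ∫ x, (|g.dalembertian η x - g.innerDual x (mvfderiv (𝓡 n) V x).toLinearMap
        (mvfderiv (𝓡 n) η x).toLinearMap| * Real.exp (-V x)) * Φ (w x) ∂g.riemVolume := by
  -- smoothness
  have hΦ' : ContDiff ℝ ∞ (deriv Φ) := (contDiff_infty_iff_deriv.1 hΦ).2
  have hΦd : ∀ t, HasDerivAt Φ (deriv Φ t) t := fun t ↦ (hΦ.differentiable (by simp) t).hasDerivAt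
  have hΦ'd : ∀ t, HasDerivAt (deriv Φ) (deriv (deriv Φ) t) t := fun t ↦
    (hΦ'.differentiable (by simp) t).hasDerivAt
  have ha : ContMDiff (𝓡 n) 𝓘(ℝ, ℝ) ∞ (fun x ↦ deriv Φ (w x) * η x) :=
    (hΦ'.comp_contMDiff hw).mul hη
  have hac : HasCompactSupport (fun x ↦ deriv Φ (w x) * η x) := hηc.mul_left
  have hΦw : ContMDiff (𝓡 n) 𝓘(ℝ, ℝ) ∞ (fun x ↦ Φ (w x)) := hΦ.comp_contMDiff hw
  have hwd : ∀ x, MDifferentiableAt (𝓡 n) 𝓘(ℝ, ℝ) w x := fun x ↦ hw.mdifferentiableAt (by simp)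
  have hηd : ∀ x, MDifferentiableAt (𝓡 n) 𝓘(ℝ, ℝ) η x := fun x ↦ hη.mdifferentiableAt (by simp)
  -- the two Green identities
  have h2le : (2 : ℕ∞ω) ≤ (∞ : ℕ∞ω) := WithTop.coe_le_coe.mpr le_top
  have hG1 := integral_mul_weightedLaplacian_of_hasCompactSupport hg (ha.of_le (by norm_num))
    (hw.of_le h2le) (hV.of_le (by norm_num)) (Or.inl hac)
  have hG2 := integral_mul_weightedLaplacian_of_hasCompactSupport hg (hΦw.of_le (by norm_num))
    (hη.of_le h2le) (hV.of_le (by norm_num)) (Or.inr hηc)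
  -- pointwise: `g⁻¹(d(Φ∘w), dη) ≤ g⁻¹(d(Φ'(w) η), dw)` (the difference is `η Φ''(w) |dw|² ≥ 0`)
  have h1 : ∀ x, (mvfderiv (𝓡 n) (fun y ↦ Φ (w y)) x).toLinearMap =
      deriv Φ (w x) • (mvfderiv (𝓡 n) w x).toLinearMap := fun x ↦ by
    ext v
    exact mvfderiv_real_comp_apply (I := 𝓡 n) (hΦd (w x)) (hwd x) v
  have h2 : ∀ x, (mvfderiv (𝓡 n) (fun y ↦ deriv Φ (w y) * η y) x).toLinearMap =
      deriv Φ (w x) • (mvfderiv (𝓡 n) η x).toLinearMap +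
        (η x * deriv (deriv Φ) (w x)) • (mvfderiv (𝓡 n) w x).toLinearMap := fun x ↦ by
    have hΦ'w : MDifferentiableAt (𝓡 n) 𝓘(ℝ, ℝ) (fun y ↦ deriv Φ (w y)) x :=
      (hΦ'.comp_contMDiff hw).mdifferentiableAt (by simp)
    ext v
    have hmul := mvfderiv_fun_mul hΦ'w (hηd x)
    have hch : mvfderiv (𝓡 n) (fun y ↦ deriv Φ (w y)) x v =
        deriv (deriv Φ) (w x) * mvfderiv (𝓡 n) w x v :=
      mvfderiv_real_comp_apply (I := 𝓡 n) (hΦ'd (w x)) (hwd x) v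
    simp only [ContinuousLinearMap.coe_coe, LinearMap.add_apply, LinearMap.smul_apply, smul_eq_mul]
    rw [hmul]
    simp only [add_apply, FunLike.coe_smul, Pi.smul_apply, smul_eq_mul, hch]
    ring
  have hpt : ∀ x, g.innerDual x (mvfderiv (𝓡 n) (fun y ↦ Φ (w y)) x).toLinearMap
        (mvfderiv (𝓡 n) η x).toLinearMap ≤
      g.innerDual x (mvfderiv (𝓡 n) (fun y ↦ deriv Φ (w y) * η y) x).toLinearMap
        (mvfderiv (𝓡 n) w x).toLinearMap := by
    intro x
    rw [h1, h2, g.innerDual_smul_left, g.innerDual_add_left, g.innerDual_smul_left,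
      g.innerDual_smul_left]
    rw [g.innerDual_comm x (mvfderiv (𝓡 n) η x).toLinearMap (mvfderiv (𝓡 n) w x).toLinearMap]
    have hsq := g.innerDual_self_nonneg hg x (mvfderiv (𝓡 n) w x).toLinearMap
    nlinarith [mul_nonneg (mul_nonneg (hη0 x) (hΦ'' (w x))) hsq]
  -- continuity and compact support of the integrands
  haveI : IsFiniteMeasureOnCompacts g.riemVolume :=
    CarrilloNi2009_shrinkerLSI.isFiniteMeasureOnCompacts_riemVolume hg
  have hec : Continuous fun x ↦ Real.exp (-V x) := Real.continuous_exp.comp hV.continuous.neg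
  obtain ⟨hLηc, hLηs⟩ := continuous_hasCompactSupport_weightedLaplacian (g := g) hη hηc hV
  have hIa : Continuous fun x ↦ g.innerDual x
      (mvfderiv (𝓡 n) (fun y ↦ deriv Φ (w y) * η y) x).toLinearMap
      (mvfderiv (𝓡 n) w x).toLinearMap :=
    continuous_innerDual_mvfderiv g (ha.of_le (by norm_num)) (hw.of_le (by norm_num))
  have hIb : Continuous fun x ↦ g.innerDual x (mvfderiv (𝓡 n) (fun y ↦ Φ (w y)) x).toLinearMap
      (mvfderiv (𝓡 n) η x).toLinearMap :=
    continuous_innerDual_mvfderiv g (hΦw.of_le (by norm_num)) (hη.of_le (by norm_num))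
  have hKa : HasCompactSupport fun x ↦ g.innerDual x
      (mvfderiv (𝓡 n) (fun y ↦ deriv Φ (w y) * η y) x).toLinearMap
      (mvfderiv (𝓡 n) w x).toLinearMap * Real.exp (-V x) := by
    refine HasCompactSupport.intro hac fun x hx ↦ ?_
    simp [mvfderiv_eq_zero_of_notMem_tsupport hx, PseudoRiemannianMetric.innerDual]
  have hKb : HasCompactSupport fun x ↦ g.innerDual x
      (mvfderiv (𝓡 n) (fun y ↦ Φ (w y)) x).toLinearMap
      (mvfderiv (𝓡 n) η x).toLinearMap * Real.exp (-V x) := by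
    refine HasCompactSupport.intro hηc fun x hx ↦ ?_
    simp [mvfderiv_eq_zero_of_notMem_tsupport hx, PseudoRiemannianMetric.innerDual]
  have ia := (hIa.mul hec).integrable_of_hasCompactSupport (μ := g.riemVolume) hKa
  have ib := (hIb.mul hec).integrable_of_hasCompactSupport (μ := g.riemVolume) hKb
  have ic : Integrable (fun x ↦ Φ (w x) * (g.dalembertian η x - g.innerDual x
      (mvfderiv (𝓡 n) V x).toLinearMap (mvfderiv (𝓡 n) η x).toLinearMap) * Real.exp (-V x))
      g.riemVolume :=
    ((hΦw.continuous.mul hLηc).mul hec).integrable_of_hasCompactSupport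
      ((hLηs.mul_left).mul_right)
  have id : Integrable (fun x ↦ (|g.dalembertian η x - g.innerDual x
      (mvfderiv (𝓡 n) V x).toLinearMap (mvfderiv (𝓡 n) η x).toLinearMap| * Real.exp (-V x)) *
      Φ (w x)) g.riemVolume :=
    (((hLηc.abs).mul hec).mul hΦw.continuous).integrable_of_hasCompactSupport
      (((hLηs.comp_left (g := fun t : ℝ ↦ |t|) abs_zero).mul_right).mul_right)
  -- the chain
  calc ∫ x, (η x * Real.exp (-V x)) * (deriv Φ (w x) * (g.dalembertian w x -
          g.innerDual x (mvfderiv (𝓡 n) V x).toLinearMap (mvfderiv (𝓡 n) w x).toLinearMap))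
          ∂g.riemVolume
      = ∫ x, (deriv Φ (w x) * η x) * (g.dalembertian w x -
          g.innerDual x (mvfderiv (𝓡 n) V x).toLinearMap (mvfderiv (𝓡 n) w x).toLinearMap) *
          Real.exp (-V x) ∂g.riemVolume :=
        integral_congr_ae (Eventually.of_forall fun x ↦ by ring)
    _ = -∫ x, g.innerDual x (mvfderiv (𝓡 n) (fun y ↦ deriv Φ (w y) * η y) x).toLinearMap
          (mvfderiv (𝓡 n) w x).toLinearMap * Real.exp (-V x) ∂g.riemVolume := hG1
    _ ≤ -∫ x, g.innerDual x (mvfderiv (𝓡 n) (fun y ↦ Φ (w y)) x).toLinearMap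
          (mvfderiv (𝓡 n) η x).toLinearMap * Real.exp (-V x) ∂g.riemVolume :=
        neg_le_neg (integral_mono ib ia fun x ↦
          mul_le_mul_of_nonneg_right (hpt x) (Real.exp_pos _).le)
    _ = ∫ x, Φ (w x) * (g.dalembertian η x - g.innerDual x
          (mvfderiv (𝓡 n) V x).toLinearMap (mvfderiv (𝓡 n) η x).toLinearMap) * Real.exp (-V x)
          ∂g.riemVolume := hG2.symm
    _ ≤ ∫ x, (|g.dalembertian η x - g.innerDual x (mvfderiv (𝓡 n) V x).toLinearMap
          (mvfderiv (𝓡 n) η x).toLinearMap| * Real.exp (-V x)) * Φ (w x) ∂g.riemVolume := by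
        refine integral_mono ic id fun x ↦ ?_
        have hΦx := hΦ0 (w x)
        have hex := (Real.exp_pos (-V x)).le
        have hle := le_abs_self (g.dalembertian η x - g.innerDual x
          (mvfderiv (𝓡 n) V x).toLinearMap (mvfderiv (𝓡 n) η x).toLinearMap)
        nlinarith [mul_nonneg hΦx hex, mul_le_mul_of_nonneg_left hle (mul_nonneg hΦx hex)]

end Weighted

/-- **Registered helper `helper_weightedGreenCompactSupport`** (line `collapsed-ends-usc`): the
weighted Green identity `∫ a (Lb) e^{-V} = −∫ g⁻¹(da, db) e^{-V}`, `a` or `b` compactly supported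
(`integral_mul_weightedLaplacian_of_hasCompactSupport`, written out). [cite: BakryGentilLedoux2014,
§3.2 (integration by parts on weighted manifolds for compactly supported functions)] -/
theorem helper_weightedGreenCompactSupport : ∀ (n : ℕ) (M : Type*) [TopologicalSpace M] [T2Space M] [SecondCountableTopology M] [ChartedSpace (EuclideanSpace ℝ (Fin n)) M] [IsManifold (𝓡 n) ∞ M] [T3Space M] [MeasurableSpace M] [BorelSpace M] (g : PseudoRiemannianMetric (𝓡 n) ∞ (EuclideanSpace ℝ (Fin n)) (TangentSpace (𝓡 n) : M → Type _)) [g.HasLeviCivita] (V : M → ℝ), g.IsRiemannian → ContMDiff (𝓡 n) 𝓘(ℝ, ℝ) 1 V → ∀ (a b : M → ℝ), ContMDiff (𝓡 n) 𝓘(ℝ, ℝ) 1 a → ContMDiff (𝓡 n) 𝓘(ℝ, ℝ) 2 b → (HasCompactSupport a ∨ HasCompactSupport b) → ∫ x, a x * (g.dalembertian b x - g.innerDual x (mvfderiv (𝓡 n) V x).toLinearMap (mvfderiv (𝓡 n) b x).toLinearMap) * Real.exp (-V x) ∂g.riemVolume = -∫ x, g.innerDual x (mvfderiv (𝓡 n)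 a x).toLinearMap (mvfderiv (𝓡 n) b x).toLinearMap * Real.exp (-V x) ∂g.riemVolume :=
  fun _ _ _ _ _ _ _ _ _ _ _ _ _ hg hV _ _ ha hb hc ↦
    integral_mul_weightedLaplacian_of_hasCompactSupport hg ha hb hV hc

end Summit.SmoothPoincare4.SmoothPoincare4.Theorems.NoncompactShrinkerGapHeat

end
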